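import Literature.AnabelianGeometry.EtaleTheta.Discharge.Sec5OfThetaSetting
import Literature.AnabelianGeometry.EtaleTheta.FrobenioidMonoThetaKummerExtension

/-!
# [EtTh] Lemma 5.8 at the genuine §5 data: «`N`-torsion birational units are units» (L58-B2, second half) is a THEOREM —
# `(K^×)^{1/N}/μ_N(B_N) ⥲ K^×`'s kernel clause from the perfection of `Φ` (Lem 5.8 p.331 / PDF p.105; [FrdI] Thm 5.2 (ii))

Mochizuki, *The étale theta function …*, Publ. RIMS **45** (2009), Lemma 5.8 p.331 (PDF p.105): "`(K^×)^{1/N} ⊆ O^×(B_N^birat)` for the subgroup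
of elements whose `N`-th power lies in the image of the natural inclusion `K^× ↪ O^×(B_N^birat)`; `(O_K^×)^{1/N} := (K^×)^{1/N} ∩ O^×(B_N)` … a
natural outer action of `(O_K^×)^{1/N}/μ_N(B_N) (⥲ O_K^×)` … `(K^×)^{1/N}/μ_N(B_N) (⥲ K^×)`"; [FrdI] Thm. 5.2 (ii) (the units of a model
Frobenioid, "`O^×(A) ↪ O^×(A^birat)`").  [cite: MochizukiEtTh2009, Lem 5.8 p.331 (PDF p.105)] [cite: MochizukiFrdI2008, Thm. 5.2(ii) p.101]

abc-iut cell, layer L2, seat abc-iut-L2-t4 (§5 owner, gen 4), ROW W3-L2-01; PROOF-ONLY (no definition, no named fact; nothing landed is edited).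
abc-iut-L2-t4's named clause `KxRootNModCyclotome` (the input `hK` of the `DK` pin `Sec5DKOfThetaSetting.lean` and of abc-iut-L2-t11's
`kummerOut`) was REDUCED by abc-iut-w4-d095 (`kxRootNModCyclotome_of`, `FrobenioidMonoThetaKummerExtension.lean`, K5 row L58-B2) to
(hsurj) «every constant has an `N`-th root in `O^×(B_N^birat)`» + (h5) «the `N`-torsion of `(K^×)^{1/N} ⊆ O^×(B_N^birat)` consists of units».
THIS FILE PROVES (h5) — for ALL `N`-torsion birational units — at every §5 datum whose Frobenioid is a MODEL Frobenioid ([FrdI] Thm. 5.2), in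
particular at the genuine data over `B^temp(Π^tp_X)⁰` and at the data of the Setting, from ONE structural input: the value group `Φ(B_N^bs)^gp` is
torsion-free — which holds for every tempered Frobenioid because `Φ` is PERFECT and integral (Def. 3.6 (ii): `Φ` perf-factorial, group-saturated in
the realification; Prop. 5.1: "`Φ` perfect"):
* `ModelFrobenioid.mem_range_unitsToRatFn_of_divB_eq_one` — a birational unit `u ∈ B(A)^×` with `Div_B(u) = 0` IS (the image of) a unit of the
  model Frobenioid: the base-identity linear automorphism `(1, id, 0, u)` of abc-iut-L1's `unitAut`;
* `ModelFrobenioid.mem_range_unitsToRatFn_of_pow_eq_one` — hence so is every `N`-torsion birational unit when `Φ(A)^gp` is torsion-free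
  (`N · Div_B(u) = Div_B(u^N) = 0`);
* `Frobenioids.isTorsionFree_grothendieckGroup_of_isPerfect` — `M` perfect and integral ⇒ `M^gp` torsion-free;
* `ThetaFrobenioid.h5_ofConnectedTemperoidData` / `h5_ofThetaSettingData` — (h5) at the genuine data / at the Setting (input `hP`, the perfection
  of `Φ` already carried by the setting), and `kxRootNModCyclotome_ofConnectedTemperoidData_of_surj` / `…_ofThetaSettingData_of_surj`:
  **`hK` ⟸ (hsurj) alone**.
HONEST FRAMING: kernel-checked; (hsurj) («`K^×` has `N`-th roots in `O^×(B_N^birat)`», i.e. the base field of `B_N` contains `K(k^{1/N} : k ∈ K)`)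
remains a printed input; nothing of [EtTh] is asserted unconditionally; no side taken on [IUTchIII] Cor. 3.12; typed ≠ proved.
-/

noncomputable section

open CategoryTheory Opposite

/-! ### Monoids: perfect + integral ⇒ torsion-free Grothendieck group -/

namespace Literature.AlgebraicGeometry.Frobenioids

universe w

/-- **`M` perfect and integral ⇒ `M^gp` torsion-free** ([FrdI] §0 p.11: a perfect monoid has bijective `n`-th power maps; integral: `M ↪ M^gp`):
if `x = a/b ∈ M^gp` has `x^n = 1` then `a^n = b^n` in `M`, so `a = b`.  [cite: MochizukiFrdI2008, §0 p.11] -/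
theorem isTorsionFree_grothendieckGroup_of_isPerfect {M : Type w} [CommMonoid M] (hP : IsPerfect M) (hI : IsIntegral M) :
    IsTorsionFree (Algebra.GrothendieckGroup M) := by
  refine ⟨fun x n hn hx => ?_⟩
  obtain ⟨⟨a, b⟩, h⟩ := (Localization.monoidOf (⊤ : Submonoid M)).surj x
  have hb : x = Algebra.GrothendieckGroup.of a / Algebra.GrothendieckGroup.of (b : M) := eq_div_iff_mul_eq'.mpr h
  have hab : a ^ n = (b : M) ^ n := by
    apply hI.injective_of
    rw [map_pow, map_pow, ← div_eq_one, ← div_pow, ← hb, hx]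
  have hab' : a = (b : M) := (hP.bijective_pow n hn).1 hab
  rw [hb, hab', div_self']

end Literature.AlgebraicGeometry.Frobenioids

/-! ### Model Frobenioids: birational units with trivial divisor / of finite order are units -/

namespace Literature.AlgebraicGeometry.Frobenioids.ModelFrobenioid

universe w v u

variable {D : Type u} [Category.{v} D] {Φ B : Dᵒᵖ ⥤ CommMonCat.{w}} {DivB : B ⟶ monoidGp Φ}

/-- **A birational unit with trivial divisor is a unit** ([FrdI] Thm. 5.2 (ii): `O^×(A) ↪ O^×(A^birat) = B(A)^×` with image the kernel of
`Div_B`): for `u ∈ B(A_D)^×` with `Div_B(u) = 0`, the base-identity linear automorphism `(1, id, 0, u)` of `X = (A_D, α)` is a unit mapping to `u`.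
[cite: MochizukiFrdI2008, Thm. 5.2(ii) p.101] -/
theorem mem_range_unitsToRatFn_of_divB_eq_one (X : ModelFrobenioid Φ B DivB) (u : (B.obj (op X.base))ˣ)
    (hu : divB Φ B DivB (op X.base) (u : B.obj (op X.base)) = 1) : u ∈ (unitsToRatFn X).range := by
  have hu' : divB Φ B DivB (op X.base) ((u⁻¹ : (B.obj (op X.base))ˣ) : B.obj (op X.base)) = 1 := by
    have h := congrArg (divB Φ B DivB (op X.base)) u.inv_mul
    rw [map_mul, map_one, hu, mul_one] at h
    exact h
  have h : Algebra.GrothendieckGroup.of (1 : Φ.obj (op X.base)) = divB Φ B DivB (op X.base) (u : B.obj (op X.base)) := by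
    rw [map_one, hu]
  have h' : Algebra.GrothendieckGroup.of (1 : Φ.obj (op X.base)) =
      divB Φ B DivB (op X.base) ((u⁻¹ : (B.obj (op X.base))ˣ) : B.obj (op X.base)) := by
    rw [map_one, hu']
  refine ⟨⟨unitAut X 1 1 (u : B.obj (op X.base)) ((u⁻¹ : (B.obj (op X.base))ˣ) : B.obj (op X.base)) h h' (one_mul 1)
    (by exact_mod_cast u.inv_mul), unitAut_mem_units X 1 1 _ _ h h' _ _⟩, ?_⟩
  exact Units.ext rfl

/-- **A birational unit of finite order is a unit when `Φ(A_D)^gp` is torsion-free**: `Div_B(u)^n = Div_B(u^n) = 0` forces `Div_B(u) = 0`.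
(«`N`-torsion roots are units»: the kernel clause of [EtTh] Lemma 5.8's "`(K^×)^{1/N}/μ_N(B_N) ⥲ K^×`".)
[cite: MochizukiFrdI2008, Thm. 5.2(ii) p.101] [cite: MochizukiEtTh2009, Lem 5.8 p.331 (PDF p.105)] -/
theorem mem_range_unitsToRatFn_of_pow_eq_one (X : ModelFrobenioid Φ B DivB)
    (htf : IsTorsionFree (Algebra.GrothendieckGroup (Φ.obj (op X.base)))) (u : (B.obj (op X.base))ˣ) {n : ℕ} (hn : 0 < n)
    (hu : u ^ n = 1) : u ∈ (unitsToRatFn X).range := by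
  refine mem_range_unitsToRatFn_of_divB_eq_one X u (htf.eq_one_of_pow_eq_one _ n hn ?_)
  rw [← map_pow, ← Units.val_pow_eq_pow_val, hu, Units.val_one, map_one]

end Literature.AlgebraicGeometry.Frobenioids.ModelFrobenioid

/-! ### At the genuine §5 data over `B^temp(Π^tp_X)⁰` and at the §5 data of the Setting -/

namespace Literature.AnabelianGeometry.EtaleTheta

open Literature.AlgebraicGeometry.Frobenioids Literature.AnabelianGeometry.SemiGraphs
  Literature.AnabelianGeometry.SemiGraphs.GaloisObjects Literature.AlgebraicGeometry.Frobenioids.QuasiTemperoid.BTempConnected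

universe u₀ v₀ w

namespace ThetaFrobenioid

section Connected

variable {K : Type u₀} [Field K] {X : SemiGraphs.TemperedArithmeticGroup.{u₀} K} {D₀ : Type u₀} [Category.{v₀} D₀]
  {V : FrdIMonoidStub.{w}} {T₀ : RealifiedDivisorMonoids (D₀ := D₀) V}
  {VD : FrdICatStub.{u₀ + 1, u₀, w} (ConnectedPart (BTemp X.Pi))}
  {tf : TemperedFrobenioid T₀ (ConnectedPart (BTemp X.Pi)) VD} {hZ : tf.monoidType = MonoidType.Z}
  {hP : ∀ A : (ConnectedPart (BTemp X.Pi))ᵒᵖ, IsPerfect (tf.Φ.carrier A)}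
  {NH : Subgroup (Field.absoluteGaloisGroup K) → tf.category → ℕ+ → Prop} {A₀ : tf.category}
  {hA₀ : PreFrobenioid.IsFrobeniusTrivial tf.toElem A₀} {hA₀' : SemiGraphs.IsGaloisObj A₀.base.obj}
  {pullFrac : ∀ {A A' : (BiKummerSetting.mkOfConnectedTemperoid X tf hZ hP NH A₀ hA₀ hA₀').C} (_ : A' ⟶ A),
    (BiKummerSetting.mkOfConnectedTemperoid X tf hZ hP NH A₀ hA₀ hA₀').biratUnits A →
      (BiKummerSetting.mkOfConnectedTemperoid X tf hZ hP NH A₀ hA₀ hA₀').biratUnits A'}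
  {lv N : ℕ+} {T : ThetaEnvData.{max u₀ w} N}
  {θ : (BiKummerSetting.mkOfConnectedTemperoid X tf hZ hP NH A₀ hA₀ hA₀').biratUnits
    (BiKummerSetting.mkOfConnectedTemperoid X tf hZ hP NH A₀ hA₀ hA₀').Aodot}
  {Bl : (BiKummerSetting.mkOfConnectedTemperoid X tf hZ hP NH A₀ hA₀ hA₀').C}
  {Pl : (BiKummerSetting.mkOfConnectedTemperoid X tf hZ hP NH A₀ hA₀ hA₀').FractionPair θ Bl}
  {Rl : (BiKummerSetting.mkOfConnectedTemperoid X tf hZ hP NH A₀ hA₀ hA₀').NthRoot θ Pl lv pullFrac}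
  (h : ModelFrobenioid.Hypotheses tf.divisorMonoid tf.ratFnFunctor)
  (Q : FrobenioidTheta.ThetaSubquotientStub.{w} (ConnectedPart (BTemp X.Pi))) (odd_l : Odd (lv : ℕ))
  (R : (BiKummerSetting.mkOfConnectedTemperoid X tf hZ hP NH A₀ hA₀ hA₀').NthRoot Rl.root Rl.pair N pullFrac)
  (ιX : T.PiX ≃ₜ* X.Pi) (K' : Type w) [Field K'] (constEmb : K'ˣ →* tf.biratUnitsModel R.BN)
  (constEmb_injective : Function.Injective constEmb)
  (hinvc : ∀ g : Aut R.AN.base,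
    pull tf.divisorMonoid g.hom (ModelFrobenioid.div R.pair.num) = ModelFrobenioid.div R.pair.num)
  (hinvp : ∀ y : T.PiX, y ∈ T.PiYdd →
    pull tf.divisorMonoid ((BiKummerSetting.mkOfConnectedTemperoid X tf hZ hP NH A₀ hA₀ hA₀').galoisSurj R.AN.base
      R.αData.isGalois (ιX y)).hom (ModelFrobenioid.div R.pair.den) = ModelFrobenioid.div R.pair.den)

include h in
/-- **`Φ(B_N^bs)^gp` is torsion-free** for the tempered Frobenioid of the setting: `Φ` is perfect (the setting's input `hP`, Prop. 5.1 "`Φ` perfect")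
and integral (`Φ` divisorial, [FrdI] Def. 1.1 (i), from `h`).  [cite: MochizukiEtTh2009, Prop 5.1 p.323 (PDF p.97)] -/
theorem isTorsionFree_divisorMonoidGp_BN :
    IsTorsionFree (Algebra.GrothendieckGroup (tf.divisorMonoid.obj (op R.BN.base))) :=
  isTorsionFree_grothendieckGroup_of_isPerfect (hP (op R.BN.base)) (h.isDivisorial R.BN.base).isPreDivisorial.isIntegral

/-- **(h5) «`N`-torsion birational units are units» at the genuine §5 data over `B^temp(Π^tp_X)⁰`**: every `f ∈ O^×(B_N^birat)` with `f^n = 1`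
(`n ≥ 1`) lies in the image of "the natural inclusion" `O^×(B_N) ↪ O^×(B_N^birat)` ([FrdI] Thm. 5.2 (ii); Lemma 5.8's kernel clause) — a THEOREM,
from the perfection of `Φ`.  [cite: MochizukiEtTh2009, Lem 5.8 p.331 (PDF p.105)] -/
theorem h5_ofConnectedTemperoidData
    (f : (ofConnectedTemperoidData h Q odd_l R ιX K' constEmb constEmb_injective hinvc hinvp).biratUnits
      (ofConnectedTemperoidData h Q odd_l R ιX K' constEmb constEmb_injective hinvc hinvp).BN) {n : ℕ} (hn : 0 < n)
    (hf : f ^ n = 1) :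
    f ∈ ((ofConnectedTemperoidData h Q odd_l R ιX K' constEmb constEmb_injective hinvc hinvp).unitsToBirat
      (ofConnectedTemperoidData h Q odd_l R ιX K' constEmb constEmb_injective hinvc hinvp).BN).range :=
  ModelFrobenioid.mem_range_unitsToRatFn_of_pow_eq_one R.BN (isTorsionFree_divisorMonoidGp_BN h R) f hn hf

/-- **`hK` at the genuine data from (hsurj) ALONE**: abc-iut-L2-t4's `KxRootNModCyclotome` ("`(K^×)^{1/N}/μ_N(B_N) ⥲ K^×`") holds for the genuine
§5 data given only that every constant has an `N`-th root in `O^×(B_N^birat)` (abc-iut-w4-d095's `kxRootNModCyclotome_of` with (h5) discharged).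
[cite: MochizukiEtTh2009, Lem 5.8 p.331 (PDF p.105)] -/
theorem kxRootNModCyclotome_ofConnectedTemperoidData_of_surj
    (hsurj : ∀ k : K'ˣ, ∃ f ∈ (ofConnectedTemperoidData h Q odd_l R ιX K' constEmb constEmb_injective hinvc hinvp).KxRootN,
      f ^ (N : ℕ) = constEmb k) :
    (ofConnectedTemperoidData h Q odd_l R ιX K' constEmb constEmb_injective hinvc hinvp).KxRootNModCyclotome :=
  (ofConnectedTemperoidData h Q odd_l R ιX K' constEmb constEmb_injective hinvc hinvp).kxRootNModCyclotome_of hsurj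
    fun f _ hf => h5_ofConnectedTemperoidData h Q odd_l R ιX K' constEmb constEmb_injective hinvc hinvp f N.pos hf

end Connected

section Setting

variable {p : ℕ} [Fact p.Prime] {D : ThetaSetting p} {E : D.EtaleThetaData} {l : ℕ} {C : E.DoubleUnderline l}
  {e : D.toTemperedCurve.GroupLevelData} {N : ℕ+} (μ : D.CyclotomeMod l N) (hC : D.Compat) (hS : D.Sec2Hyps)
  {D₀ : Type} [Category.{v₀} D₀] {V : FrdIMonoidStub.{0}} {T₀ : RealifiedDivisorMonoids (D₀ := D₀) V}
  {VD : FrdICatStub.{1, 0, 0} (ConnectedPart (BTemp (C.temperedArithmeticGroup e).Pi))}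
  {tf : TemperedFrobenioid T₀ (ConnectedPart (BTemp (C.temperedArithmeticGroup e).Pi)) VD} {hZ : tf.monoidType = MonoidType.Z}
  {hP : ∀ A : (ConnectedPart (BTemp (C.temperedArithmeticGroup e).Pi))ᵒᵖ, IsPerfect (tf.Φ.carrier A)}
  {NH : Subgroup (Field.absoluteGaloisGroup D.K) → tf.category → ℕ+ → Prop} {A₀ : tf.category}
  {hA₀ : PreFrobenioid.IsFrobeniusTrivial tf.toElem A₀} {hA₀' : SemiGraphs.IsGaloisObj A₀.base.obj}
  {pullFrac : ∀ {A A' : (BiKummerSetting.mkOfConnectedTemperoid (C.temperedArithmeticGroup e) tf hZ hP NH A₀ hA₀ hA₀').C} (_ : A' ⟶ A),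
    (BiKummerSetting.mkOfConnectedTemperoid (C.temperedArithmeticGroup e) tf hZ hP NH A₀ hA₀ hA₀').biratUnits A →
      (BiKummerSetting.mkOfConnectedTemperoid (C.temperedArithmeticGroup e) tf hZ hP NH A₀ hA₀ hA₀').biratUnits A'}
  {θ : (BiKummerSetting.mkOfConnectedTemperoid (C.temperedArithmeticGroup e) tf hZ hP NH A₀ hA₀ hA₀').biratUnits
    (BiKummerSetting.mkOfConnectedTemperoid (C.temperedArithmeticGroup e) tf hZ hP NH A₀ hA₀ hA₀').Aodot}
  {Bl : (BiKummerSetting.mkOfConnectedTemperoid (C.temperedArithmeticGroup e) tf hZ hP NH A₀ hA₀ hA₀').C}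
  {Pl : (BiKummerSetting.mkOfConnectedTemperoid (C.temperedArithmeticGroup e) tf hZ hP NH A₀ hA₀ hA₀').FractionPair θ Bl}
  {Rl : (BiKummerSetting.mkOfConnectedTemperoid (C.temperedArithmeticGroup e) tf hZ hP NH A₀ hA₀ hA₀').NthRoot θ Pl C.lPNat pullFrac}
  (h : ModelFrobenioid.Hypotheses tf.divisorMonoid tf.ratFnFunctor)
  (Q : FrobenioidTheta.ThetaSubquotientStub.{0} (ConnectedPart (BTemp (C.temperedArithmeticGroup e).Pi)))
  (R : (BiKummerSetting.mkOfConnectedTemperoid (C.temperedArithmeticGroup e) tf hZ hP NH A₀ hA₀ hA₀').NthRoot Rl.root Rl.pair N pullFrac)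
  (K' : Type) [Field K'] (constEmb : K'ˣ →* tf.biratUnitsModel R.BN) (constEmb_injective : Function.Injective constEmb)
  (hinvc : ∀ g : Aut R.AN.base,
    pull tf.divisorMonoid g.hom (ModelFrobenioid.div R.pair.num) = ModelFrobenioid.div R.pair.num)
  (hinvp : ∀ y : (C.thetaEnvData μ hC hS).PiX, y ∈ (C.thetaEnvData μ hC hS).PiYdd →
    pull tf.divisorMonoid ((BiKummerSetting.mkOfConnectedTemperoid (C.temperedArithmeticGroup e) tf hZ hP NH A₀ hA₀ hA₀').galoisSurj
      R.AN.base R.αData.isGalois ((ContinuousMulEquiv.refl _) y)).hom (ModelFrobenioid.div R.pair.den) = ModelFrobenioid.div R.pair.den)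

/-- **(h5) at the §5 data OF THE SETTING.** [cite: MochizukiEtTh2009, Lem 5.8 p.331 (PDF p.105)] -/
theorem h5_ofThetaSettingData
    (f : (ofThetaSettingData μ hC hS h Q R K' constEmb constEmb_injective hinvc hinvp).biratUnits
      (ofThetaSettingData μ hC hS h Q R K' constEmb constEmb_injective hinvc hinvp).BN) {n : ℕ} (hn : 0 < n) (hf : f ^ n = 1) :
    f ∈ ((ofThetaSettingData μ hC hS h Q R K' constEmb constEmb_injective hinvc hinvp).unitsToBirat
      (ofThetaSettingData μ hC hS h Q R K' constEmb constEmb_injective hinvc hinvp).BN).range :=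
  h5_ofConnectedTemperoidData (T := C.thetaEnvData μ hC hS) h Q C.odd_lPNat R (ContinuousMulEquiv.refl _) K' constEmb constEmb_injective
    hinvc hinvp f hn hf

/-- **`hK` at the Setting from (hsurj) alone.** [cite: MochizukiEtTh2009, Lem 5.8 p.331 (PDF p.105)] -/
theorem kxRootNModCyclotome_ofThetaSettingData_of_surj
    (hsurj : ∀ k : K'ˣ, ∃ f ∈ (ofThetaSettingData μ hC hS h Q R K' constEmb constEmb_injective hinvc hinvp).KxRootN,
      f ^ (N : ℕ) = constEmb k) :
    (ofThetaSettingData μ hC hS h Q R K' constEmb constEmb_injective hinvc hinvp).KxRootNModCyclotome :=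
  kxRootNModCyclotome_ofConnectedTemperoidData_of_surj (T := C.thetaEnvData μ hC hS) h Q C.odd_lPNat R (ContinuousMulEquiv.refl _) K'
    constEmb constEmb_injective hinvc hinvp hsurj

end Setting

end ThetaFrobenioid

end Literature.AnabelianGeometry.EtaleTheta

end
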